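import Summits.AtomisticToContinuum.HydrodynamicLimit.Theorems.RelayRaceLocalityNearConstantShortTimeHLFluxIntegrability
import Summits.AtomisticToContinuum.HydrodynamicLimit.Theorems.RelayRaceLocalityNearConstantShortTimeHLSolutionTests
import Literature.MathematicalPhysics.KineticTheory.HardSphereBBGKYLiouvilleFlow
import HarnessLib

/-!
# Crux `NearConstantShortTimeHL` (stmt-AtomisticToContinuum-12502), line `small-tilt-domination`:
# integrability in time along hard-sphere orbits (part A)

Support file for the crux `…Theses.RelayRaceLocality.NearConstantShortTimeHL`, line `small-tilt-domination`
(lead c3, wave 2), registered stubs `intervalIntegrable_sum_orbit` (this file) and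
`intervalIntegrable_integral_ballRate_orbit` (part B, `…OrbitIntegrabilityB.lean`).

Along the orbit `r ↦ Φ_r z` of a GOOD initial datum of a hard-sphere flow on `𝕋³`:

* `wf_measurable_flow` — `r ↦ Φ_r z` is measurable (joint measurability of the flow on `ℝ × good`,
  `HardSphereFlow.measurable_piecewise_flow`); positions are moreover continuous (`IsHardSphereTrajectory.pos_continuous`);
* `wf_norm_vel_le` — speeds are bounded by `√(2E(z))` uniformly in time (conservation of kinetic energy,
  `HardSphereFlow.configEnergy_flow`, with `wg_norm_vel_le` of `…FluxIntegrability`);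
* **`intervalIntegrable_sum_orbit`** — raw one-body sums `Σᵢ g(r, xᵢ(r)) G(vᵢ(r))` with `g` continuous on `[a, b] × 𝕋³` and
  `G` continuous are interval integrable on `[a, b]` (continuous times bounded measurable);
* tools for part B: bounds of the ball-averaged fields by the kernel height and the speed bound (`wf_ballFields_le`),
  continuity of CLAMPED-in-time coefficient fields built from a field jointly smooth on `[0, T') × 𝕋³` (`wf_continuous_clamp`,
  `wf_row_package`: `(r, x) ↦ ∂ₜf(clamp r, x)`, `∂ₖf(clamp r, ·)(x)` are continuous on `ℝ × 𝕋³` and bounded on `[a, b] × 𝕋³`,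
  via the open quotient map `ℝ × ℝ³ → ℝ × 𝕋³`) and measurability of the entropy-rate density `Θ` at measurable arguments
  (`wf_measurable_entropyRate`; the measurable ball fields and pressure law are `wg_measurable_*` of `…FluxIntegrability`).

No definitions, no named facts. References: R. K. Alexander, PhD thesis (1975) Ch. 2 (measurability of the flow);
H.-T. Yau, Lett. Math. Phys. 22 (1991) §2.
-/

noncomputable section

namespace Summit.AtomisticToContinuum.HydrodynamicLimit.Theorems.NearConstantShortTimeHL

open scoped BigOperators ENNReal
open MeasureTheory Set Filter
open Literature.MathematicalPhysics.KineticTheory Literature.Analysis.FluidPDE Literature.Analysis.FunctionSpaces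

variable {ε : ℝ} {n : ℕ}

/-! ### The orbit of a good point: measurability and the speed bound -/

/-- Along a good orbit of a hard-sphere flow on `𝕋³`, `r ↦ Φ_r z` is measurable (from the joint measurability of
`(r, z) ↦ good.piecewise Φ_r id z`, `HardSphereFlow.measurable_piecewise_flow`). [cite: Alexander1975, Ch. 2] -/
theorem wf_measurable_flow (Φ : HardSphereFlow (Torus.geometry (Fin 3)) ε n) {z : Config n (Fin 3) T3}
    (hz : z ∈ Φ.good) : Measurable fun r : ℝ => Φ.flow r z := by
  classical
  have h := Φ.measurable_piecewise_flow_comp Torus.continuous_geometry_translate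
    (τ := fun r : ℝ => r) (ζ := fun _ : ℝ => z) measurable_id measurable_const
  refine (funext fun r => ?_ : (fun r : ℝ => Φ.good.piecewise (Φ.flow r) id z) = fun r => Φ.flow r z) ▸ h
  exact piecewise_flow_of_mem Φ r hz

/-- **Speed bound along a good orbit**: `‖vᵢ(r)‖ ≤ √(2E(z))` for every time `r` and particle `i`, `E(z) = ½Σ‖vᵢ‖²`
the (conserved) kinetic energy. [cite: GST2013, §1.1] -/
theorem wf_norm_vel_le (Φ : HardSphereFlow (Torus.geometry (Fin 3)) ε n) {z : Config n (Fin 3) T3}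
    (hz : z ∈ Φ.good) (r : ℝ) (i : Fin n) :
    ‖((Φ.flow r z) i).2‖ ≤ Real.sqrt (2 * configEnergy z) := by
  rw [← Φ.configEnergy_flow hz r]
  exact wg_norm_vel_le (Φ.flow r z) i

/-! ### Registered stub `intervalIntegrable_sum_orbit` -/

/-- **Registered stub `intervalIntegrable_sum_orbit`.** Along a good orbit, for `g` continuous on `[a, b] × 𝕋³` and
`G : ℝ³ → ℝ` continuous, `r ↦ Σᵢ g(r, xᵢ(r)) G(vᵢ(r))` is interval integrable on `[a, b]`: each summand is the product
of the continuous `r ↦ g(r, xᵢ(r))` (positions are continuous) with the bounded measurable `r ↦ G(vᵢ(r))` (the flow is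
measurable in time and speeds are bounded by energy conservation, `G` is bounded on that ball). [folklore] -/
theorem intervalIntegrable_sum_orbit : ∀ {ε : ℝ} {n : ℕ} (Φ : HardSphereFlow (Torus.geometry (Fin 3)) ε n) {z : Config n (Fin 3) T3}, z ∈ Φ.good → ∀ {a b : ℝ}, a ≤ b → ∀ {g : ℝ → T3 → ℝ}, ContinuousOn (Function.uncurry g) (Set.Icc a b ×ˢ Set.univ) → ∀ {G : V3 → ℝ}, Continuous G → IntervalIntegrable (fun r => ∑ i, g r ((Φ.flow r z) i).1 * G ((Φ.flow r z) i).2) volume a b := by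
  intro ε n Φ z hz a b hab g hg G hG
  obtain ⟨C, hC⟩ := (isCompact_closedBall (0 : V3) (Real.sqrt (2 * configEnergy z))).exists_bound_of_continuousOn
    hG.continuousOn
  have hsum : (fun r => ∑ i, g r ((Φ.flow r z) i).1 * G ((Φ.flow r z) i).2) =
      ∑ i : Fin n, fun r => g r ((Φ.flow r z) i).1 * G ((Φ.flow r z) i).2 := by
    funext r
    simp only [Finset.sum_apply]
  rw [hsum]
  refine IntervalIntegrable.sum _ fun i _ => ?_
  have hpos : Continuous fun r : ℝ => ((Φ.flow r z) i).1 := (Φ.isTrajectory z hz).pos_continuous i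
  have hvel : Measurable fun r : ℝ => ((Φ.flow r z) i).2 :=
    ((measurable_pi_apply i).comp (wf_measurable_flow Φ hz)).snd
  refine IntervalIntegrable.continuousOn_mul ?_ ?_
  · refine (intervalIntegrable_const (c := C)).mono_fun' (hG.measurable.comp hvel).aestronglyMeasurable ?_
    exact ae_of_all _ fun r => hC _ (mem_closedBall_zero_iff.2 (wf_norm_vel_le Φ hz r i))
  · rw [uIcc_of_le hab]
    exact hg.comp (continuousOn_id.prodMk hpos.continuousOn) fun r hr => Set.mk_mem_prod hr (Set.mem_univ _)

/-! ### Tools for part B: ball-averaged fields along the orbit -/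

/-- **Ball averages are bounded by the kernel height and the speed bound.** With `K = ((4/3)πℓ³)⁻¹` the height of
`ballKernel ℓ` and `‖vᵢ‖ ≤ V` for all `i`: `ρ̃ ≤ K`, `‖m̃‖ ≤ KV`, `ẽ ≤ KV²/2`, `c̃ = n⁻¹Σ kᵢ‖vᵢ‖³ ≤ KV³`. [folklore] -/
theorem wf_ballFields_le {ℓ : ℝ} (hℓ : 0 < ℓ) (x : T3) (w : Config n (Fin 3) T3) {V : ℝ}
    (hV0 : 0 ≤ V) (hV : ∀ i, ‖(w i).2‖ ≤ V) :
    empiricalDensityField w (ballKernel ℓ x) ≤ (4 / 3 * Real.pi * ℓ ^ 3)⁻¹ ∧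
    ‖empiricalMomentumField w (ballKernel ℓ x)‖ ≤ (4 / 3 * Real.pi * ℓ ^ 3)⁻¹ * V ∧
    empiricalEnergyField w (ballKernel ℓ x) ≤ (4 / 3 * Real.pi * ℓ ^ 3)⁻¹ * V ^ 2 / 2 ∧
    (n : ℝ)⁻¹ * ∑ i, ballKernel ℓ x (w i).1 * ‖(w i).2‖ ^ 3 ≤ (4 / 3 * Real.pi * ℓ ^ 3)⁻¹ * V ^ 3 := by
  have hK0 : 0 ≤ (4 / 3 * Real.pi * ℓ ^ 3)⁻¹ := by positivity
  have hk : ∀ y, ballKernel ℓ x y ≤ (4 / 3 * Real.pi * ℓ ^ 3)⁻¹ := fun y => by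
    unfold ballKernel
    split_ifs
    exacts [le_rfl, hK0]
  refine ⟨?_, ?_, ?_, ?_⟩
  · rw [empiricalDensityField_eq_sum]
    exact wg_avg_le (fun i => hk _) hK0
  · refine (norm_ballMomentum_le_sum ℓ x w).trans (wg_avg_le (fun i => ?_) (by positivity))
    exact mul_le_mul (hk _) (hV i) (norm_nonneg _) hK0
  · rw [empiricalEnergyField_eq_sum]
    refine wg_avg_le (fun i => ?_) (by positivity)
    have h2 : ‖(w i).2‖ ^ 2 / 2 ≤ V ^ 2 / 2 := by
      gcongr
      exact hV i
    calc ballKernel ℓ x (w i).1 * (‖(w i).2‖ ^ 2 / 2) ≤ (4 / 3 * Real.pi * ℓ ^ 3)⁻¹ * (V ^ 2 / 2) :=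
          mul_le_mul (hk _) h2 (by positivity) hK0
      _ = (4 / 3 * Real.pi * ℓ ^ 3)⁻¹ * V ^ 2 / 2 := by ring
  · refine wg_avg_le (fun i => ?_) (by positivity)
    exact mul_le_mul (hk _) (pow_le_pow_left₀ (norm_nonneg _) (hV i) 3) (by positivity) hK0

/-! ### Tools for part B: coefficient fields clamped in time -/

/-- **Clamping in time.** If the space–time lift of `c : ℝ → 𝕋³ → F'` is continuous on `S × ℝ³` and `[a, b] ⊆ S`, then
`(r, x) ↦ c (clamp_{[a,b]} r) x` is continuous on all of `ℝ × 𝕋³` (`clamp r = max a (min b r)`; continuity descends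
along the open quotient map `ℝ × ℝ³ → ℝ × 𝕋³`, `Torus.isOpenQuotientMap_proj`). [folklore] -/
theorem wf_continuous_clamp {F' : Type*} [TopologicalSpace F'] {S : Set ℝ} {c : ℝ → T3 → F'}
    (hc : ContinuousOn (Torus.stLift c) (S ×ˢ Set.univ)) {a b : ℝ} (hab : a ≤ b) (hS : Set.Icc a b ⊆ S) :
    Continuous fun p : ℝ × T3 => c (max a (min b p.1)) p.2 := by
  have hq : IsOpenQuotientMap (Prod.map (id : ℝ → ℝ) (Torus.proj : V3 → T3)) :=
    IsOpenQuotientMap.id.prodMap Torus.isOpenQuotientMap_proj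
  refine hq.continuous_comp_iff.1 ?_
  have hmem : ∀ q : ℝ × V3, (max a (min b q.1), q.2) ∈ S ×ˢ (Set.univ : Set V3) := fun q =>
    Set.mk_mem_prod (hS ⟨le_max_left _ _, max_le hab (min_le_left _ _)⟩) (Set.mem_univ _)
  have hcl : Continuous fun q : ℝ × V3 => (max a (min b q.1), q.2) :=
    (continuous_const.max (continuous_const.min continuous_fst)).prodMk continuous_snd
  exact hc.comp_continuous hcl hmem

/-- **Derivative fields of a row smooth on `[0, T') × 𝕋³`, clamped to `[a, b] ⊆ [0, T')`.** For `f` jointly smooth on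
`[0, T') × 𝕋³`, `T' ≤ T`, `0 ≤ a ≤ b < T'`: the one-sided time derivative within `[0, T)` (which agrees with the one within
`[0, T')` on `[a, b]`, `timeDerivWithin_Ico_eq_of_le`) and the spatial partial derivatives are bounded on `[a, b] × 𝕋³` by
one constant, and their clamped-in-time versions are continuous on `ℝ × 𝕋³` (`IsSmoothSpaceTimeOn.timeDerivWithin`,
`IsSmoothSpaceTimeOn.partialDeriv`, `wf_continuous_clamp`). [folklore] -/
theorem wf_row_package {F' : Type*} [NormedAddCommGroup F'] [NormedSpace ℝ F'] {T T' a b : ℝ}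
    {f : ℝ → T3 → F'} (hf : Torus.IsSmoothSpaceTimeOn (Set.Ico 0 T') f) (hT'T : T' ≤ T) (ha : 0 ≤ a)
    (hab : a ≤ b) (hb : b < T') :
    (∃ C, ∀ r ∈ Set.Icc a b, ∀ x, ‖Torus.timeDerivWithin (Set.Ico 0 T) f r x‖ ≤ C ∧
      ∀ k, ‖Torus.partialDeriv k (f r) x‖ ≤ C) ∧
    (Continuous fun p : ℝ × T3 => Torus.timeDerivWithin (Set.Ico 0 T) f (max a (min b p.1)) p.2) ∧
    ∀ k, Continuous fun p : ℝ × T3 => Torus.partialDeriv k (f (max a (min b p.1))) p.2 := by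
  have hS : UniqueDiffOn ℝ (Set.Ico (0 : ℝ) T') := uniqueDiffOn_Ico 0 T'
  have hIcc : Set.Icc a b ⊆ Set.Ico 0 T' := fun r hr => ⟨ha.trans hr.1, hr.2.trans_lt hb⟩
  have hclamp : ∀ r : ℝ, max a (min b r) ∈ Set.Icc a b := fun r =>
    ⟨le_max_left _ _, max_le hab (min_le_left _ _)⟩
  have hagree : ∀ r ∈ Set.Icc a b, ∀ x, Torus.timeDerivWithin (Set.Ico 0 T') f r x =
      Torus.timeDerivWithin (Set.Ico 0 T) f r x :=
    fun r hr x => timeDerivWithin_Ico_eq_of_le hT'T f (hIcc hr) x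
  have ht := (hf.timeDerivWithin hS).continuousOn_stLift
  have hp := fun k => (hf.partialDeriv hS k).continuousOn_stLift
  obtain ⟨C₀, hC₀⟩ := Torus.exists_norm_le_of_continuousOn_of_isCompact ht isCompact_Icc hIcc
  choose C hC using fun k => Torus.exists_norm_le_of_continuousOn_of_isCompact (hp k) isCompact_Icc hIcc
  refine ⟨⟨|C₀| + ∑ k, |C k|, fun r hr x => ⟨?_, fun k => ?_⟩⟩, ?_, fun k => ?_⟩
  · rw [← hagree r hr x]
    exact (hC₀ r hr x).trans ((le_abs_self _).trans
      (le_add_of_nonneg_right (Finset.sum_nonneg fun k _ => abs_nonneg _)))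
  · exact (hC k r hr x).trans ((le_abs_self _).trans
      ((Finset.single_le_sum (f := fun k => |C k|) (fun k _ => abs_nonneg (C k)) (Finset.mem_univ k)).trans
        (le_add_of_nonneg_left (abs_nonneg _))))
  · exact (wf_continuous_clamp ht hab hIcc).congr fun p => hagree _ (hclamp p.1) p.2
  · exact wf_continuous_clamp (hp k) hab hIcc

/-! ### Tools for part B: measurability of the entropy-rate density at measurable arguments -/

/-- The hard-sphere pressure at the state temperature, `p(ρ', θ(ρ', E', m'))`, is a measurable function of measurable
arguments `(ρ', E', m')` (`wg_measurable_hsPressure`: `deriv f_ex` is measurable; the state temperature is rational).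
[folklore] -/
theorem wf_measurable_pressure {α : Type*} [MeasurableSpace α] (σ : ℝ) {R E : α → ℝ} {M : α → V3}
    (hR : Measurable R) (hE : Measurable E) (hM : Measurable M) :
    Measurable fun a => hsPressure σ (R a) (stateTemp (R a) (E a) (M a)) := by
  have hθ : Measurable fun a => stateTemp (R a) (E a) (M a) := by
    unfold stateTemp
    exact measurable_const.mul ((hE.div hR).sub ((hM.norm.pow_const 2).div (measurable_const.mul (hR.pow_const 2))))
  exact (wg_measurable_hsPressure σ).comp (hR.prodMk hθ)

/-- **Measurability of the entropy-rate density at measurable arguments.** If the six coefficient fields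
`∂ₜλ⁰, ∂ₜλ, ∂ₜλ⁴, ∂ₖλ⁰, ∂ₖλ, ∂ₖλ⁴` evaluated at `(τ(a), ξ(a))` and the state `(R(a), E(a), M(a))` are measurable in `a`,
so is `Θ_{τ(a)}(ξ(a))(R(a), M(a), E(a))` (sums, products, quotients and the measurable pressure
`wf_measurable_pressure`). [folklore] -/
theorem wf_measurable_entropyRate {α : Type*} [MeasurableSpace α] {σ T : ℝ} {ρ θ : ℝ → T3 → ℝ}
    {u : ℝ → T3 → V3} {τ : α → ℝ} {ξ : α → T3} {R E : α → ℝ} {M : α → V3}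
    (h0 : Measurable fun a => Torus.timeDerivWithin (Set.Ico 0 T) (lam0Row σ ρ θ u) (τ a) (ξ a))
    (h1 : Measurable fun a => Torus.timeDerivWithin (Set.Ico 0 T) (lamRow θ u) (τ a) (ξ a))
    (h4 : Measurable fun a => Torus.timeDerivWithin (Set.Ico 0 T) (lam4Row θ) (τ a) (ξ a))
    (g0 : ∀ k, Measurable fun a => Torus.partialDeriv k (lam0Row σ ρ θ u (τ a)) (ξ a))
    (g1 : ∀ k, Measurable fun a => Torus.partialDeriv k (lamRow θ u (τ a)) (ξ a))
    (g4 : ∀ k, Measurable fun a => Torus.partialDeriv k (lam4Row θ (τ a)) (ξ a))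
    (hR : Measurable R) (hE : Measurable E) (hM : Measurable M) :
    Measurable fun a => entropyRate σ T ρ θ u (τ a) (ξ a) (R a) (E a) (M a) := by
  have hMj : ∀ j, Measurable fun a => M a j := fun j => wg_measurable_V3_apply hM j
  have h1j : ∀ j, Measurable fun a => Torus.timeDerivWithin (Set.Ico 0 T) (lamRow θ u) (τ a) (ξ a) j :=
    fun j => wg_measurable_V3_apply h1 j
  have g1j : ∀ k j, Measurable fun a => Torus.partialDeriv k (lamRow θ u (τ a)) (ξ a) j :=
    fun k j => wg_measurable_V3_apply (g1 k) j
  have hP : Measurable fun a => hsPressure σ (R a) (stateTemp (R a) (E a) (M a)) :=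
    wf_measurable_pressure σ hR hE hM
  have hT1 : Measurable fun a => Torus.timeDerivWithin (Set.Ico 0 T) (lam0Row σ ρ θ u) (τ a) (ξ a) * R a :=
    h0.mul hR
  have hT2 : Measurable fun a => ∑ j, Torus.timeDerivWithin (Set.Ico 0 T) (lamRow θ u) (τ a) (ξ a) j * M a j :=
    Finset.measurable_sum _ fun j _ => (h1j j).mul (hMj j)
  have hT3 : Measurable fun a => Torus.timeDerivWithin (Set.Ico 0 T) (lam4Row θ) (τ a) (ξ a) * E a :=
    h4.mul hE
  have hT4 : Measurable fun a => ∑ k, Torus.partialDeriv k (lam0Row σ ρ θ u (τ a)) (ξ a) * M a k :=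
    Finset.measurable_sum _ fun k _ => (g0 k).mul (hMj k)
  have hT5 : Measurable fun a => ∑ k, ∑ j, Torus.partialDeriv k (lamRow θ u (τ a)) (ξ a) j *
      (M a k * M a j / R a + if k = j then hsPressure σ (R a) (stateTemp (R a) (E a) (M a)) else 0) :=
    Finset.measurable_sum _ fun k _ => Finset.measurable_sum _ fun j _ =>
      (g1j k j).mul ((((hMj k).mul (hMj j)).div hR).add
        (Measurable.ite (MeasurableSet.const _) hP measurable_const))
  have hT6 : Measurable fun a => ∑ k, Torus.partialDeriv k (lam4Row θ (τ a)) (ξ a) *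
      ((E a + hsPressure σ (R a) (stateTemp (R a) (E a) (M a))) * M a k / R a) :=
    Finset.measurable_sum _ fun k _ => (g4 k).mul (((hE.add hP).mul (hMj k)).div hR)
  unfold entropyRate
  exact ((((hT1.add hT2).add hT3).add hT4).add hT5).add hT6

end Summit.AtomisticToContinuum.HydrodynamicLimit.Theorems.NearConstantShortTimeHL

end
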